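import Mathlib

/-!
# `Balaban1983to89.B3Sect2StatementsPart2` — T. Bałaban, *(Higgs)₂,₃ quantum fields in a finite volume. III.
Renormalization*, Commun. Math. Phys. **88** (1983) 411–445 [Balaban1983Higgs3]: Sect. 2, second part — the propagator bounds
(2.5), (2.10)–(2.12) used in the proof of Proposition 2.1, the Ward–Takahashi identities (2.23)–(2.25), and the vanishing
mechanism "tr q^{2n+1} = 0" of p. 434

statement-level skeleton of published theorems with citation tags; proofs where landed; nothing here is a claim about the Yang–Mills mass gap

PDF held: `paper:balaban1983-higgs-2-3-quantum-fields-finite-volume` (journal page = PDF page + 410).  Renders read as images: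
`run/shared/lean/pub/pub-balaban/b2b-balaban-ref1/pages/1983-cmp88-higgs23-III/1983-cmp88-higgs23-III-p014, p016, p020, p021,
p024-x4.png` (journal pp. 424, 426, 430, 431, 434); (2.5) re-read on a full-resolution crop of p. 424.

CITATION HEADER (lean-in-tree rule).  Part of the lit-balaban TYPED SKELETON (HOME `run/shared/lean/pub/lit-balaban/`; rows B3-17,
B3-18, B3-19, B3-24, B3-25, B3-26, B3-33 of `HOME/lit-balaban-r15/SKELETON-r15.md`).  WHAT IS REPRODUCED, and how.  (a) The
inequalities (2.5), (2.10), (2.11), (2.12) p. 424/426 as `def … : Prop` over an abstract carrier `ScaledKernels` whose fields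
NAME the printed quantities (the kernels G^η_{(j)}(Ω, B̃; x, x′) of the decomposition (2.6), their covariant derivatives and Hölder
quotients, the averaged kernels G^η_{(j)}(Γ^{(j+1)}_{x_{j+1},x}, b), the operators δG_k(Ω, Ω₂, B̃) and (1.16) between localizing
functions h, h′, distances) — the paper obtains (2.10)–(2.12) "by rescaling from the η-lattice to the L^{−j}-lattice and
application of Propositions I.2.1 and I.2.3" ([Balaban1982Higgs1], typed as `…Balaban1983to89.B1.Prop21Printed`,
`B1.Prop23Printed`; the DEPGRAPH edge, not a Lean hypothesis here) and (2.5) "from the properties of the propagators G_k(Ω, A)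
proved in the next paper" (p. 414; = [Balaban1983RegularityDecay]).  (b) The Ward–Takahashi identity **(2.23)** p. 430 — *"These
identities express a gauge invariance of the scalar field part of the theory"* — PROVED in the abstract form that IS its printed
mechanism (`integral_eq_of_gaugeInvariant`: an integral ∫ w(φ)F(φ)dφ is unchanged when the weight is replaced by w ∘ g for a
measure-preserving bijection g of field space leaving F invariant; in print g = the gauge transformation by λ, w = exp[−½⟨φ,(−Δ^η_A
+ M²)φ⟩], w ∘ g_λ = exp[−½⟨φ,(−Δ^η_{A−e_k∂^ηλ} + M²)φ⟩]); the differentiated identity **(2.24)** as its abstract skeleton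
(`deriv_eq_zero_of_invariant`) plus the displayed statement as a `def … : Prop` over a carrier of the Gaussian integral (`Eq224`);
**(2.25)** likewise (`Eq225`), together with the kernel fact that makes it and the sentence of p. 434 work: the trace of an odd
power of an antisymmetric real matrix vanishes (`trace_pow_odd_eq_zero_of_transpose_eq_neg`; p. 434: *"every graph of this type has
at least one loop of scalar field lines with an odd number of vector field legs, thus with an odd power of q, and we have
tr q^{2n+1} = 0"*).  NOT typed (rows only): the displayed instances (2.26)–(2.28) (long sums of lattice Gaussian contractions and
their graphical forms) — Phase 2, with a concrete lattice Gaussian model.  NOTHING of the paper is asserted beyond the kernel-checked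
lemmas: `Ineq25`, `Ineq210`–`Ineq212`, `Eq224`, `Eq225` are hypotheses for consumers.  Unit `lit-balaban-r15` (reader/typer r15).
-/

namespace Literature.MathematicalPhysics.QuantumFieldTheory.Balaban1983to89.B3Sect2StatementsPart2

open _root_.MeasureTheory

/-! ## (2.5), (2.10)–(2.12): the bounds on the scale pieces of the propagators -/

/-- Abstract carrier for (2.5), (2.10)–(2.12): the η-lattice T_η ∋ x with its distance, the parameters L, η = L^{−k}, d, the
running quantities e(L^kε), p(L^kε), the kernels of the scale pieces G^η_{(j)}(Ω, B̃) of (2.6) (absolute values `absG j x x′`, and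
of their covariant derivatives D^η_{B̃,μ} in the first variable, `absDG j μ x x′`), the parallel-transported Hölder difference of
(2.11) (`holderDiff j μ x₁ x₂ x` = |U(B̃(Γ_{x₁,x₂}))(D^η_{B̃,μ}G^η_{(j)})(Ω,B̃;x₂,x) − (D^η_{B̃,μ}G^η_{(j)})(Ω,B̃;x₁,x)|), the averaged
kernels |G^η_{(j)}(Γ^{(j+1)}_{x_{j+1},x}, b)| of (2.12) (`absGavg j x b`, with the coarse point x_{j+1} of x and the distance
dist(B^j(x), b) as fields), and the Hölder norms ‖h(δG_k(Ω,Ω₂,B̃))h′‖_{1,α}, ‖h(the operator (1.16) with exponents n, n′)h′‖_{1,α}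
between localizing functions h, h′ (`normDeltaG`, `norm116`), dist(Ω₂, ∂Ω) and dist(supp h, supp h′).  Carrier clauses (F6):
everything just listed is data of the instance; nothing relates the fields to each other here. [cite: Balaban1983Higgs3, (2.6), (2.10) pp.424–426] -/
structure ScaledKernels where
  /-- points of T_η -/
  Site : Type
  /-- bonds of T_η -/
  Bond : Type
  /-- directions μ = 1, …, d -/
  Dir : Type
  /-- localizing functions h -/
  LocFn : Type
  /-- |x − x′| -/
  dist : Site → Site → ℝ
  /-- dist({x₁, x₂}, x) -/
  dist2 : Site → Site → Site → ℝ
  /-- dist(B^j(x), b) for the averaged kernel of (2.12) -/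
  distBlock : ℕ → Site → Bond → ℝ
  /-- dist(supp h, supp h′) -/
  distSupp : LocFn → LocFn → ℝ
  /-- dist(Ω₂, ∂Ω) -/
  distΩ₂ : ℝ
  /-- the block size L -/
  L : ℝ
  /-- the lattice spacing η = L^{−k} -/
  η : ℝ
  /-- the dimension d -/
  d : ℕ
  /-- e(L^kε) -/
  eRun : ℝ
  /-- p(L^kε) -/
  pRun : ℝ
  one_lt_L : 1 < L
  η_pos : 0 < η
  /-- |G^η_{(j)}(Ω, B̃; x, x′)| -/
  absG : ℕ → Site → Site → ℝ
  /-- |(D^η_{B̃,μ}G^η_{(j)})(Ω, B̃; x, x′)| -/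
  absDG : ℕ → Dir → Site → Site → ℝ
  /-- |U(B̃(Γ_{x₁,x₂}))(D^η_{B̃,μ}G^η_{(j)})(Ω,B̃;x₂,x) − (D^η_{B̃,μ}G^η_{(j)})(Ω,B̃;x₁,x)| -/
  holderDiff : ℕ → Dir → Site → Site → Site → ℝ
  /-- |G^η_{(j)}(Γ^{(j+1)}_{x_{j+1},x}, b)| -/
  absGavg : ℕ → Site → Bond → ℝ
  /-- α ↦ ‖h δG_k(Ω, Ω₂, B̃) h′‖_{1,α} -/
  normDeltaG : ℝ → LocFn → LocFn → ℝ
  /-- α ↦ ‖h (the operator (1.16) with exponents n, n′) h′‖_{1,α} -/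
  norm116 : ℝ → ℕ → ℕ → LocFn → LocFn → ℝ

namespace ScaledKernels

variable (S : ScaledKernels)

/-- L^jη, the length scale of the j-th piece. [cite: Balaban1983Higgs3, (2.10) p.426] -/
noncomputable def scale (j : ℕ) : ℝ := S.L ^ j * S.η

/-- **(2.5)** p. 424 [PDF 14], verbatim: *"In the estimates we treat them as external fields and we use the inequalities:
‖h(an operator δG_k(Ω,Ω₂,B̃) or (1.16))h′‖_{1,α} ≤ O(e^{−δ₀dist(Ω₂,∂Ω)} or (e(L^kε)p(L^kε))^{n+n′})e^{−δ₀dist(supp h, supp h′)}, (2.5)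
where h, h′ are functions giving the localizations of the vertices."* — at constants (α, δ₀, O(1) = C), both alternatives.
[cite: Balaban1983Higgs3, (2.5) p.424] -/
def Ineq25 (α δ₀ C : ℝ) : Prop :=
  (∀ h h' : S.LocFn, S.normDeltaG α h h' ≤ C * Real.exp (-(δ₀ * S.distΩ₂)) * Real.exp (-(δ₀ * S.distSupp h h'))) ∧
  (∀ (n n' : ℕ) (h h' : S.LocFn),
    S.norm116 α n n' h h' ≤ C * (S.eRun * S.pRun) ^ (n + n') * Real.exp (-(δ₀ * S.distSupp h h')))

/-- **(2.10)** p. 426 [PDF 16], verbatim: *"For the propagators G^η_{(j)} we apply the inequality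
|G^η_{(j)}(Ω, B̃; x, x′)| ≤ O(1)(L^jη)^{−d+2}e^{−δ₁(L^jη)^{−1}|x−x′|}, (2.10) and if the propagator is differentiated, then for each
differentiation, there is an additional factor (L^jη)^{−1} on the right side."* — at constants (δ₁, O(1) = C), the undifferentiated
and the once-differentiated kernel. [cite: Balaban1983Higgs3, (2.10) p.426] -/
def Ineq210 (δ₁ C : ℝ) : Prop :=
  ∀ (j : ℕ) (x x' : S.Site),
    S.absG j x x' ≤ C * S.scale j ^ (2 - (S.d : ℝ)) * Real.exp (-(δ₁ * (S.scale j)⁻¹ * S.dist x x')) ∧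
    ∀ μ : S.Dir, S.absDG j μ x x' ≤ C * S.scale j ^ (1 - (S.d : ℝ)) * Real.exp (-(δ₁ * (S.scale j)⁻¹ * S.dist x x'))

/-- **(2.11)** p. 426 [PDF 16], verbatim: *"This applies also to Hölder norms, e.g. we have
(1/|x₂−x₁|^α)|U(B̃(Γ_{x₁,x₂}))(D^η_{B̃,μ}G^η_{(j)})(Ω,B̃;x₂,x) − (D^η_{B̃,μ}G^η_{(j)})(Ω,B̃;x₁,x)| ≤
O(1)(L^jη)^{−d+1−α}e^{−δ₁(L^jη)^{−1}dist({x₁,x₂},x)}, 0 ≤ α < 1. (2.11)"* [cite: Balaban1983Higgs3, (2.11) p.426] -/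
def Ineq211 (δ₁ C : ℝ) : Prop :=
  ∀ (α : ℝ), 0 ≤ α → α < 1 → ∀ (j : ℕ) (μ : S.Dir) (x₁ x₂ x : S.Site), x₁ ≠ x₂ →
    S.holderDiff j μ x₁ x₂ x / S.dist x₁ x₂ ^ α ≤
      C * S.scale j ^ (1 - (S.d : ℝ) - α) * Real.exp (-(δ₁ * (S.scale j)⁻¹ * S.dist2 x₁ x₂ x))

/-- **(2.12)** p. 426 [PDF 16], verbatim: *"If a leg A′ of the line is in one of the vertices (1.14) and (1.15), then we have the
expression A′^{(j),η}(Γ^{j+1}_{x_{j+1},x}) on the basis of (1.3). For each such expression we have an additional factor L^jη on the right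
side, e.g. we have |G^η_{(j)}(Γ^{(j+1)}_{x_{j+1},x}, b)| ≤ O(1)(L^jη)^{−d+3}e^{−δ₁(L^jη)^{−1}dist(B^j(x),b)}. (2.12)"*
[cite: Balaban1983Higgs3, (2.12) p.426] -/
def Ineq212 (δ₁ C : ℝ) : Prop :=
  ∀ (j : ℕ) (x : S.Site) (b : S.Bond),
    S.absGavg j x b ≤ C * S.scale j ^ (3 - (S.d : ℝ)) * Real.exp (-(δ₁ * (S.scale j)⁻¹ * S.distBlock j x b))

end ScaledKernels

/-! ## The Ward–Takahashi identities (2.23)–(2.25) -/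

/-- **(2.23)** p. 430 [PDF 20], verbatim: *"To define the renormalized classes G_ren we have to consider at first the
Ward–Takahashi identities. These identities express a gauge invariance of the scalar field part of the theory. The basic identity
has the form: ∫dφ exp[−½⟨φ,(−Δ^η_{A−e_k∂^ηλ} + M²)φ⟩]F(φ) = ∫dφ exp[−½⟨φ,(−Δ^η_A + M²)φ⟩]F(φ), (2.23) where e_k = e(L^kε), M² > 0,
F(φ) is an arbitrary gauge-invariant function of scalar fields."* — PROVED in the abstract form of its mechanism: for a
measure-preserving measurable bijection `g` of field space (in print: the gauge transformation of the scalar fields by λ, which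
preserves dφ), a weight `w` (= exp[−½⟨φ,(−Δ^η_A + M²)φ⟩]) and its transform `wg = w ∘ g` (= exp[−½⟨φ,(−Δ^η_{A−e_k∂^ηλ} + M²)φ⟩], the
covariance of the covariant Laplacian), and a `g`-invariant `F`, the two integrals agree.  The lattice facts in parentheses are
what an instantiation supplies; nothing else is used. [cite: Balaban1983Higgs3, (2.23) p.430] -/
theorem integral_eq_of_gaugeInvariant {Φ : Type*} [MeasurableSpace Φ] (μ : Measure Φ) (g : Φ ≃ᵐ Φ)
    (hg : MeasurePreserving g μ μ) (w wg F : Φ → ℝ) (hw : ∀ φ, wg φ = w (g φ)) (hF : ∀ φ, F (g φ) = F φ) :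
    ∫ φ, wg φ * F φ ∂μ = ∫ φ, w φ * F φ ∂μ := by
  have h1 : (fun φ => wg φ * F φ) = fun φ => (fun ψ => w ψ * F ψ) (g φ) := by
    funext φ
    simp only [hw φ, hF φ]
  rw [h1]
  exact hg.integral_comp' (fun ψ => w ψ * F ψ)

/-- The skeleton of **(2.24)** p. 430 [PDF 20] (*"Taking a first order differential with respect to λ we get"*): a function of
the gauge parameter that is constant (by (2.23) along t ↦ tλ) and differentiable at 0 has derivative 0 there — so whatever the
differentiated integrand is (in print ∫dφ exp[−½⟨φ,(−Δ^η_A + M²)φ⟩]F(φ)⟨D^η_Aφ, ∂^ηλqφ⟩), it vanishes.  The differentiation under the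
integral sign is the instantiation's. [cite: Balaban1983Higgs3, (2.24) p.430] -/
theorem deriv_eq_zero_of_invariant {f : ℝ → ℝ} {D : ℝ} (hconst : ∀ t, f t = f 0) (hD : HasDerivAt f D 0) : D = 0 := by
  have h : f = fun _ => f 0 := funext hconst
  rw [h] at hD
  exact hD.unique (hasDerivAt_const (0 : ℝ) (f 0))

/-- Abstract carrier of the Gaussian integrals of (2.24)–(2.25): scalar field configurations φ (N real components per site), the
(unnormalized) integral `gaussA F` = ∫dφ exp[−½⟨φ,(−Δ^η_A + M²)φ⟩]F(φ) for the background A of the identity, the normalized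
Gaussian mean `meanC F` = ∫dμ_{C^η_{M²}}(φ)F(φ) (A = 0), gauge-invariant functions F, gauge functions λ, and the two printed
pairings φ ↦ ⟨D^η_Aφ, ∂^ηλqφ⟩ and φ ↦ ⟨∂^ηφ, ∂^ηλqφ⟩.  Carrier clauses (F6): lattice, N, q, M² > 0, e_k = e(L^kε) and the measure
are data of the instance. [cite: Balaban1983Higgs3, (2.23)–(2.25) pp.430–431] -/
structure WTData where
  /-- scalar field configurations -/
  Field : Type
  /-- gauge functions λ -/
  GaugeFn : Type
  /-- "an arbitrary gauge-invariant function of scalar fields" F -/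
  InvFn : Type
  /-- evaluation of F -/
  evalF : InvFn → Field → ℝ
  /-- F ↦ ∫dφ exp[−½⟨φ,(−Δ^η_A + M²)φ⟩] F(φ) -/
  gaussA : (Field → ℝ) → ℝ
  /-- F ↦ ∫dμ_{C^η_{M²}}(φ) F(φ) -/
  meanC : (Field → ℝ) → ℝ
  /-- φ ↦ ⟨D^η_A φ, ∂^ηλ qφ⟩ -/
  pairDA : GaugeFn → Field → ℝ
  /-- φ ↦ ⟨∂^η φ, ∂^ηλ qφ⟩ -/
  pairD : GaugeFn → Field → ℝ

/-- **(2.24)** p. 430 [PDF 20], verbatim: *"Taking a first order differential with respect to λ we get: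
∫dφ exp[−½⟨φ,(−Δ^η_A + M²)φ⟩]F(φ)⟨D^η_Aφ, ∂^ηλqφ⟩ = 0. (2.24)"* — for every gauge-invariant F and every λ of the datum.
[cite: Balaban1983Higgs3, (2.24) p.430] -/
def Eq224 (W : WTData) : Prop :=
  ∀ (F : W.InvFn) (lam : W.GaugeFn), W.gaussA (fun φ => W.evalF F φ * W.pairDA lam φ) = 0

/-- **(2.25)** p. 431 [PDF 21], verbatim: *"Taking F = 1, A = 0, we get ∫dμ_{C^η_{M²}}(φ)⟨∂^ηφ, ∂^ηλqφ⟩ = 0. (2.25)"*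
[cite: Balaban1983Higgs3, (2.25) p.431] -/
def Eq225 (W : WTData) : Prop :=
  ∀ lam : W.GaugeFn, W.meanC (W.pairD lam) = 0

/-! ## "tr q^{2n+1} = 0" (p. 434) and the trace mechanism behind (2.25) -/

/-- The trace of an antisymmetric real square matrix vanishes (kernel step of (2.25): with E[φ_a(x)φ_b(x′)] = δ_{ab}C^η_{M²}(x,x′)
the Gaussian mean of ⟨∂^ηφ, ∂^ηλ qφ⟩ is a sum of terms C·tr q = 0). [cite: Balaban1983Higgs3, (2.25) p.431] -/
theorem trace_eq_zero_of_transpose_eq_neg {n : Type*} [Fintype n] (q : Matrix n n ℝ) (hq : q.transpose = -q) :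
    q.trace = 0 := by
  have h := congrArg Matrix.trace hq
  rw [Matrix.trace_transpose, Matrix.trace_neg] at h
  linarith

/-- p. 434 [PDF 24], verbatim: *"At first let us remark that the expressions corresponding to graphs with an odd number of external
vector field legs (and no other external legs) are equal to 0. This follows from the fact that every graph of this type has at
least one loop of scalar field lines with an odd number of vector field legs, thus with an odd power of q, and we have
tr q^{2n+1} = 0. Thus we have no divergent subgraphs with one or three external vector field legs."* — the algebraic fact,
kernel-checked: an odd power of an antisymmetric real matrix is antisymmetric, hence traceless.
[cite: Balaban1983Higgs3, p.434] -/
theorem trace_pow_odd_eq_zero_of_transpose_eq_neg {n : Type*} [Fintype n] [DecidableEq n] (q : Matrix n n ℝ)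
    (hq : q.transpose = -q) (m : ℕ) : (q ^ (2 * m + 1)).trace = 0 := by
  apply trace_eq_zero_of_transpose_eq_neg
  rw [Matrix.transpose_pow, hq, Odd.neg_pow ⟨m, rfl⟩]

/-- The charge matrix of the abelian Higgs model on ℝ² ≅ ℂ (multiplication by i), q = [[0, −1], [1, 0]], is antisymmetric — so the
two lemmas above apply to it (non-vacuity of their hypothesis for the model's q). [cite: Balaban1983Higgs3, p.434] -/
theorem chargeMatrix_transpose : (!![(0 : ℝ), -1; 1, 0]).transpose = -!![(0 : ℝ), -1; 1, 0] := by
  ext i j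
  fin_cases i <;> fin_cases j <;> simp

/-! ## (2.11) at a FIXED Hölder exponent α (gen-5 append, 2026-08-21; GAPS G-B3-11 owner decision)

The display (2.11) p. 426 [PDF 16] reads, verbatim (render `…-p016-x2.png` re-checked 2026-08-21T07:31Z):
*"(1/|x₂−x₁|^α)|U(B̃(Γ_{x₁,x₂}))(D^η_{B̃,μ}G^η_{(j)})(Ω,B̃;x₂,x) − (D^η_{B̃,μ}G^η_{(j)})(Ω,B̃;x₁,x)| ≤
O(1)(L^jη)^{−d+1−α}e^{−δ₁(L^jη)^{−1}dist({x₁,x₂},x)}, 0 ≦ α < 1. (2.11)"*, and p. 426 continues *"They all are obtained by rescaling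
from the η-lattice to the L^{−j}-lattice and application of Propositions I.2.1 and I.2.3."* The constant O(1) of Proposition I.2.1
(= [Balaban1983Regularity] Thm 1.1′, «c₀ depends on α also») depends on α, and α is the paper's FIXED Hölder exponent (p. 414:
*"where α > 0 but can be arbitrarily small"*). The gen-1 typing `ScaledKernels.Ineq211 δ₁ C` quantifies `∀ α ∈ [0,1)` INSIDE one pair
(δ₁, C), i.e. it asks for a constant uniform in α — stronger than the print (and not what [B4] (2.36) supplies: its constant blows up as
α → 1; reading note GAPS G-B3-11, seat p03 gen 4). The decl of record for row B3.Eq2.11 is henceforth `Ineq211At α δ₁ C` below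
(the display at one α; the ∀α∃(δ₁,C) packaging is left to the consumers, like the constants of (2.10)/(2.12)); `Ineq211` is kept unchanged as the uniform variant and implies every `Ineq211At`. -/

namespace ScaledKernels

variable (S : ScaledKernels)

/-- **(2.11) at a fixed Hölder exponent α** (0 ≤ α < 1), constants δ₁, O(1) = C allowed to depend on α — the printed reading of
p. 426 (O(1) from Proposition I.2.1 depends on α). DECL OF RECORD for row B3.Eq2.11 (GAPS G-B3-11 owner decision, r15 gen 5).
[cite: Balaban1983Higgs3, (2.11) p.426] -/
def Ineq211At (α δ₁ C : ℝ) : Prop :=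
  ∀ (j : ℕ) (μ : S.Dir) (x₁ x₂ x : S.Site), x₁ ≠ x₂ →
    S.holderDiff j μ x₁ x₂ x / S.dist x₁ x₂ ^ α ≤
      C * S.scale j ^ (1 - (S.d : ℝ) - α) * Real.exp (-(δ₁ * (S.scale j)⁻¹ * S.dist2 x₁ x₂ x))

/-- The gen-1 uniform-in-α form `Ineq211 δ₁ C` is exactly «`Ineq211At α δ₁ C` for every 0 ≤ α < 1 with the SAME (δ₁, C)».
[cite: Balaban1983Higgs3, (2.11) p.426] -/
theorem ineq211_iff_forall_ineq211At (δ₁ C : ℝ) :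
    S.Ineq211 δ₁ C ↔ ∀ α : ℝ, 0 ≤ α → α < 1 → S.Ineq211At α δ₁ C := Iff.rfl

/-- Hence the uniform form implies the printed per-α form at every admissible α. [cite: Balaban1983Higgs3, (2.11) p.426] -/
theorem Ineq211.ineq211At {δ₁ C : ℝ} (h : S.Ineq211 δ₁ C) {α : ℝ} (h0 : 0 ≤ α) (h1 : α < 1) :
    S.Ineq211At α δ₁ C := h α h0 h1

end ScaledKernels


/-! ## (2.5) at FIXED expansion orders n, n′ (gen-13 append, 2026-08-23; located typing note of seat p40 gen 70)

The display (2.5) p. 424 [PDF 14] (verbatim above, in `Ineq25`) bounds «an operator δG_k(Ω,Ω₂,B̃) or (1.16)»; the operator (1.16)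
p. 414 [PDF 4] is the LAST TERM of the two-sided expansion of G_k(Ω, Ã + B̃) by (I.3.44)–(I.3.45) at expansion orders n, n′, and
print fixes these orders once, large: *"It follows easily from the properties of the propagators G_k(Ω, A) proved in the next paper
that for n, n′ sufficiently large, a kernel of the operator (1.16) is a sufficiently regular function of both variables"* (p. 414).
The gen-1 typing `ScaledKernels.Ineq25 α δ₀ C` quantifies `∀ (n n' : ℕ)` INSIDE one constant C in its second clause, i.e. it asks
for the (1.16)-alternative uniformly in (n, n′) down to n = n′ = 0 — where the operator (1.16) is G_k(Ω, Ã + B̃) itself, whose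
(1.32)-norm between OVERLAPPING localizations h, h′ is not bounded uniformly in k (the scalar propagator kernel at coinciding points
grows like η^{2−d}, d = 3, resp. log η⁻¹, d = 2, η = L^{−k}; seat p40 gen 70, HOME/STATUS 2026-08-23T00:38:33Z) — STRONGER than
the print, which asserts the bound only for the fixed large orders of (I.3.45).  As for (2.11)/G-B3-11 (`Ineq211At` above), the
DECL OF RECORD for row B3.Eq2.5 is henceforth the per-(n, n′) form `Ineq25At n n' α δ₀ C` below (constants allowed to depend on the
fixed orders; a consumer that needs «n + n′ ≥ n₀» states it on its side); `Ineq25` is kept unchanged (42 importing modules; every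
landed member discharges it with `norm116 := 0`, i.e. for the δG_k alternative only) and implies every `Ineq25At`. -/

namespace ScaledKernels

variable (S : ScaledKernels)

/-- **(2.5) at fixed expansion orders `n`, `n′`** of (I.3.45)/(1.16): the δG_k alternative (clause 1, unchanged) and the (1.16)
alternative for THIS pair (n, n′) only, constants (δ₀, O(1) = C) allowed to depend on (α, n, n′) — the printed reading of p. 424 with
p. 414 *"for n, n′ sufficiently large"*.  DECL OF RECORD for row B3.Eq2.5 (owner decision r15 gen 13 on p40 gen 70's located typing
note).  [cite: Balaban1983Higgs3, (2.5) p.424] -/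
def Ineq25At (n n' : ℕ) (α δ₀ C : ℝ) : Prop :=
  (∀ h h' : S.LocFn, S.normDeltaG α h h' ≤ C * Real.exp (-(δ₀ * S.distΩ₂)) * Real.exp (-(δ₀ * S.distSupp h h'))) ∧
  (∀ h h' : S.LocFn,
    S.norm116 α n n' h h' ≤ C * (S.eRun * S.pRun) ^ (n + n') * Real.exp (-(δ₀ * S.distSupp h h')))

/-- The gen-1 uniform-in-(n, n′) form `Ineq25 α δ₀ C` is exactly «`Ineq25At n n' α δ₀ C` for every n, n′ with the SAME (δ₀, C)».
[cite: Balaban1983Higgs3, (2.5) p.424] -/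
theorem ineq25_iff_forall_ineq25At (α δ₀ C : ℝ) :
    S.Ineq25 α δ₀ C ↔ ∀ n n' : ℕ, S.Ineq25At n n' α δ₀ C :=
  ⟨fun h n n' => ⟨h.1, fun g g' => h.2 n n' g g'⟩, fun h => ⟨(h 0 0).1, fun n n' g g' => (h n n').2 g g'⟩⟩

/-- Hence the uniform form implies the printed per-(n, n′) form at every pair of orders. [cite: Balaban1983Higgs3, (2.5) p.424] -/
theorem Ineq25.ineq25At {α δ₀ C : ℝ} (h : S.Ineq25 α δ₀ C) (n n' : ℕ) : S.Ineq25At n n' α δ₀ C :=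
  (S.ineq25_iff_forall_ineq25At α δ₀ C).1 h n n'

/-- The δG_k alternative (clause 1) is the same statement in both forms. [cite: Balaban1983Higgs3, (2.5) p.424] -/
theorem Ineq25At.deltaG {n n' : ℕ} {α δ₀ C : ℝ} (h : S.Ineq25At n n' α δ₀ C) (g g' : S.LocFn) :
    S.normDeltaG α g g' ≤ C * Real.exp (-(δ₀ * S.distΩ₂)) * Real.exp (-(δ₀ * S.distSupp g g')) :=
  h.1 g g'

end ScaledKernels


end Literature.MathematicalPhysics.QuantumFieldTheory.Balaban1983to89.B3Sect2StatementsPart2
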